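import Summits.KontsevichZagierPeriods.KontsevichZagierPeriods.Theorems.LinRedNormalFormArrangementNormalFormSeparateTwoZeroTerminal
import Summits.KontsevichZagierPeriods.KontsevichZagierPeriods.Theorems.LinRedNormalFormArrangementNormalFormSeparateTwoZeroInduction
import Summits.KontsevichZagierPeriods.KontsevichZagierPeriods.Theorems.LinRedNormalFormArrangementNormalFormSeparateTwoZeroDissect
import Summits.KontsevichZagierPeriods.KontsevichZagierPeriods.Theorems.LinRedNormalFormArrangementNormalFormSeparateTwoZeroLetters
import Summits.KontsevichZagierPeriods.KontsevichZagierPeriods.Theorems.LinRedNormalFormArrangementNormalFormSeparateDominated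

/-!
# `stub_separateTwoZero`: separation in a good rational direction, planar case

(Line `janus-bands`, crux `ArrangementNormalForm`, stub `stub_separateTwoZero` — separation in a
good rational direction for PLANAR arrangement representations without fibres; part `Stub`.)

The piece theorem (`piece_theorem`: on a good piece in good coordinates, the far-first
separation `sepV_induction` with the terminal theorem `terminal`, the vertex `V` being the
special point in the closed piece if any) and the registered stub `stub_separateTwoZero`
(`dissect` + `piece_theorem`; degenerate zero letters give the zero integrand).
-/

noncomputable section

open Set MeasureTheory Filter Topology
open scoped ENNReal

namespace Summit.KontsevichZagierPeriods.ArrangementNormalForm.JanusBands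

open Literature.NumberTheory.Transcendental

namespace SepTwoZero

open SeparatePos MvPolynomial

section PieceThm

/-- **Piece theorem.** A planar arrangement representation on a GOOD piece (final coordinates:
every special point `X ∈ 𝒳` has the double cone given by two rows through it, two special
points are separated by a row, crossings of active `y`-letters lie in `𝒳`, letters do not
vanish on the open piece, `y`-free letters are bounded away from zero) is congruent modulo
`KZ.relations` to a `ℤ`-combination of elements of `GG 1 1 0`: far-first separation
(`sepV_induction`) with the terminal theorem (`terminal`). -/
theorem piece_theorem {m m' : ℕ} (s : KZ.IntegralRep (1 + 1 + 0))
    (M : Fin m' → (Fin (1 + 1) → ℚ) × ℚ) (L : Fin m → (Fin (1 + 1) → ℚ) × ℚ) (e : Fin m → ℕ)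
    (p : MvPolynomial (Fin (1 + 1)) ℚ) (a : Fin 0 → Option ((Fin (1 + 1) → ℚ) × ℚ))
    (lo up : Fin 0 → Fin 0 ⊕ ((Fin (1 + 1) → ℚ) × ℚ))
    (hbd : Bornology.IsBounded s.domain) (hdom : s.domain = gDom 1 0 m' M lo up)
    (hint : EqOn s.integrand (fun z => MvPolynomial.aeval (fun i => z (Fin.castAdd 0 i)) p /
      (∏ j, affF 1 0 (L j) z ^ e j) * fib 1 0 a z) s.domain)
    (𝒳 : Finset (ℚ × ℚ))
    (HX : ∀ i i' (X : ℚ × ℚ), e i ≠ 0 → e i' ≠ 0 → (L i).1 1 ≠ 0 → (L i').1 1 ≠ 0 →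
      evq (L i) X = 0 → evq (L i') X = 0 → (L i).1 0 * (L i').1 1 ≠ (L i).1 1 * (L i').1 0 → X ∈ 𝒳)
    (Ha : ∀ X ∈ 𝒳, ∃ j j', evq (M j) X = 0 ∧ evq (M j') X = 0 ∧ (M j).1 1 < 0 ∧ 0 < (M j').1 1)
    (Hb : ∀ X ∈ 𝒳, ∀ X' ∈ 𝒳, X ≠ X' → ∃ j, evq (M j) X * evq (M j) X' < 0)
    (hpole : ∀ i, e i ≠ 0 → ∀ z ∈ s.domain, affF 1 0 (L i) z ≠ 0)
    (Hv : ∀ i, e i ≠ 0 → (L i).1 1 = 0 → ∃ c₀ > 0, ∀ z ∈ s.domain, c₀ ≤ |affF 1 0 (L i) z|) :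
    ∃ c ∈ AddSubgroup.closure (GGset 1 1 0), KZ.of s - c ∈ KZ.relations := by
  classical
  have hl1 : (Fin.last 1 : Fin (1 + 1)) = 1 := rfl
  -- the separation shape of the input
  set lam : Fin m → (Fin 1 → ℚ) × ℚ := fun j => root 1 (L j) with hlam
  set d : Fin m → ℕ := fun j => if (L j).1 (Fin.last 1) = 0 then 0 else e j with hdd
  set Lb : Fin m → (Fin 1 → ℚ) × ℚ := fun j => if (L j).1 (Fin.last 1) = 0 then restr 1 (L j)
    else (0, 1) with hLb
  set eb : Fin m → ℕ := fun j => if (L j).1 (Fin.last 1) = 0 then e j else 0 with heb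
  set p' : MvPolynomial (Fin (1 + 1)) ℚ := MvPolynomial.C (∏ j, lead 1 (L j) (e j))⁻¹ * p with hp'
  have hd : ∀ j, d j ≠ 0 → (L j).1 1 ≠ 0 ∧ e j ≠ 0 := fun j hj => by
    have hdj : d j = if (L j).1 (Fin.last 1) = 0 then 0 else e j := rfl
    by_cases h : (L j).1 (Fin.last 1) = 0
    · rw [hdj, if_pos h] at hj; exact absurd rfl hj
    · rw [hdj, if_neg h] at hj; exact ⟨h, hj⟩
  have hshape : EqOn s.integrand (shape 1 0 p' Lb eb lam d a) s.domain := fun z hz => by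
    rw [hint hz]; exact jshape_eq L e _ a z
  -- the vertex
  set V : ℚ × ℚ := if h : ∃ X ∈ 𝒳, rpt X ∈ closure s.domain then h.choose else (0, 0) with hV
  have hVuniq : ∀ X ∈ 𝒳, rpt X ∈ closure s.domain → X = V := by
    intro X hX hXcl
    have hex : ∃ X ∈ 𝒳, rpt X ∈ closure s.domain := ⟨X, hX, hXcl⟩
    have hVs : V ∈ 𝒳 ∧ rpt V ∈ closure s.domain := by
      rw [hV, dif_pos hex]; exact hex.choose_spec
    by_contra hne
    obtain ⟨j, hj⟩ := Hb X hX V hVs.1 hne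
    rw [hdom] at hXcl hVs
    exact not_both_mem_closure M lo up j hj hXcl hVs.2
  -- the hypotheses of the far-first separation
  have hbd' : Bornology.IsBounded (gDom 1 0 m' M lo up) := hdom ▸ hbd
  have hfar : ∀ j j', ((L j).1 1 ≠ 0 ∧ e j ≠ 0) → ((L j').1 1 ≠ 0 ∧ e j' ≠ 0) →
      ¬ ((lam j).1 0 * V.1 + (lam j).2 = V.2) → lam j ≠ lam j' →
      ∃ c₀ > 0, ∀ z ∈ gDom 1 0 m' M lo up, c₀ ≤ |affB 1 0 (lam j - lam j') z| := by
    rintro j j' ⟨hyj, hej⟩ ⟨hyj', hej'⟩ hfarj hne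
    by_cases hs : (lam j).1 0 = (lam j').1 0
    · have ht : (lam j).2 ≠ (lam j').2 := fun h => hne ((root_eq_iff _ _).2 ⟨hs, h⟩)
      refine ⟨|(((lam j).2 - (lam j').2 : ℚ) : ℝ)|, abs_pos.2 (by exact_mod_cast sub_ne_zero.2 ht),
        fun z _ => le_of_eq ?_⟩
      rw [affB_sub, affB_eq, affB_eq, hs]; push_cast; ring_nf
    · obtain ⟨X, hX, hX', hdet, hwall⟩ := exists_cross hyj hyj' hs
      have hXm : X ∈ 𝒳 := HX j j' X hej hej' hyj hyj' hX hX' hdet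
      have hXV : X ≠ V := fun h => hfarj ((near_iff hyj V).2 (h ▸ hX))
      have hXcl : rpt X ∉ closure (gDom 1 0 m' M lo up) := fun h =>
        hXV (hVuniq X hXm (hdom ▸ h))
      obtain ⟨f, g, hf, hg, hβ, hβ'⟩ := Ha X hXm
      obtain ⟨c₀, hc₀, hb⟩ := fst_sub_bounded_below M lo up hf hg hβ hβ' hbd' hXcl
      have hss : (0 : ℝ) < |(((lam j).1 0 - (lam j').1 0 : ℚ) : ℝ)| :=
        abs_pos.2 (by exact_mod_cast sub_ne_zero.2 hs)
      refine ⟨|(((lam j).1 0 - (lam j').1 0 : ℚ) : ℝ)| * c₀, by positivity, fun z hz => ?_⟩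
      rw [hwall z, abs_mul]
      exact mul_le_mul_of_nonneg_left (hb z hz) (abs_nonneg _)
  have hnear : ∀ j j', ((L j).1 1 ≠ 0 ∧ e j ≠ 0) → ((L j').1 1 ≠ 0 ∧ e j' ≠ 0) →
      ((lam j).1 0 * V.1 + (lam j).2 = V.2) → ((lam j').1 0 * V.1 + (lam j').2 = V.2) →
      lam j ≠ lam j' →
      (∃ C, ∀ z ∈ gDom 1 0 m' M lo up, |z (Fin.castAdd 0 (Fin.last 1)) - affB 1 0 (lam j') z| ≤
        C * |affB 1 0 (lam j) z - affB 1 0 (lam j') z|) ∧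
      (∃ a₁ b₁ : ℚ, ∀ z ∈ gDom 1 0 m' M lo up, (a₁ : ℝ) * (z 0 - V.1) < z 1 - V.2 ∧
        z 1 - V.2 < (b₁ : ℝ) * (z 0 - V.1)) := by
    rintro j j' ⟨hyj, hej⟩ ⟨hyj', hej'⟩ hnj hnj' hne
    obtain ⟨hs, hwall⟩ := wall_of_near hnj hnj' hne
    have hVm : V ∈ 𝒳 := by
      obtain ⟨X, hX, hX', hdet, -⟩ := exists_cross hyj hyj' hs
      have h1 : evq (L j) V = 0 := (near_iff hyj V).1 hnj
      have h2 : evq (L j') V = 0 := (near_iff hyj' V).1 hnj'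
      exact HX j j' V hej hej' hyj hyj' h1 h2 hdet
    obtain ⟨f, g, hf, hg, hβ, hβ'⟩ := Ha V hVm
    have hcone := cone_of_rows M lo up hf hg hβ hβ'
    set a₁ : ℚ := -(M g).1 0 / (M g).1 1 with ha₁
    set b₁ : ℚ := -(M f).1 0 / (M f).1 1 with hb₁
    refine ⟨⟨(|(a₁ : ℝ)| + |(b₁ : ℝ)| + |((lam j').1 0 : ℝ)|) / |(((lam j).1 0 - (lam j').1 0 : ℚ) : ℝ)|,
      fun z hz => ?_⟩, a₁, b₁, hcone⟩
    obtain ⟨h1, h2⟩ := hcone z hz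
    have hss : (0 : ℝ) < |(((lam j).1 0 - (lam j').1 0 : ℚ) : ℝ)| :=
      abs_pos.2 (by exact_mod_cast sub_ne_zero.2 hs)
    rw [← affB_sub, hwall z, abs_mul, div_mul_eq_mul_div, mul_comm (|(((lam j).1 0 -
      (lam j').1 0 : ℚ) : ℝ)|), ← mul_assoc, mul_div_assoc, div_self hss.ne', mul_one]
    have hy : z (Fin.castAdd 0 (Fin.last 1)) - affB 1 0 (lam j') z =
        (z 1 - V.2) - ((lam j').1 0 : ℝ) * (z 0 - V.1) := by
      rw [cA1, affB_eq]
      have : ((lam j').2 : ℝ) = V.2 - (lam j').1 0 * V.1 := by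
        have h : (lam j').2 = V.2 - (lam j').1 0 * V.1 := by linarith
        exact_mod_cast h
      rw [this]; ring
    rw [hy]
    have hv : |z 1 - V.2| ≤ (|(a₁ : ℝ)| + |(b₁ : ℝ)|) * |z 0 - V.1| := by
      have e1 : (b₁ : ℝ) * (z 0 - V.1) ≤ |(b₁ : ℝ)| * |z 0 - V.1| := by
        rw [← abs_mul]; exact le_abs_self _
      have e2 : -((a₁ : ℝ) * (z 0 - V.1)) ≤ |(a₁ : ℝ)| * |z 0 - V.1| := by
        rw [← abs_mul]; exact neg_le_abs _
      rw [abs_le]; constructor <;> nlinarith [abs_nonneg (a₁ : ℝ), abs_nonneg (b₁ : ℝ),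
        abs_nonneg (z 0 - V.1)]
    calc _ ≤ |z 1 - V.2| + |((lam j').1 0 : ℝ) * (z 0 - V.1)| := abs_sub _ _
      _ ≤ (|(a₁ : ℝ)| + |(b₁ : ℝ)|) * |z 0 - V.1| + |((lam j').1 0 : ℝ)| * |z 0 - V.1| := by
          rw [abs_mul]; exact add_le_add hv le_rfl
      _ = _ := by ring
  have hpole' : ∀ j, d j ≠ 0 → ∀ z ∈ s.domain,
      z (Fin.castAdd 0 (Fin.last 1)) - affB 1 0 (lam j) z ≠ 0 := fun j hj z hz => by
    obtain ⟨hα, he⟩ := hd j hj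
    have h := hpole j he z hz
    rw [affF_of_ne_zero (L j) z hα] at h
    exact right_ne_zero_of_mul h
  have hact : ∀ j, d j ≠ 0 → (L j).1 1 ≠ 0 ∧ e j ≠ 0 := hd
  have hinv0 : ∀ l, eb l ≠ 0 → (∃ c₀ > 0, ∀ z ∈ s.domain, c₀ ≤ |affB 1 0 (Lb l) z|) ∨
      (((Lb l).1 0 ≠ 0 ∧ (Lb l).1 0 * V.1 + (Lb l).2 = 0 ∧ (∃ i, d i ≠ 0) ∧
        (∀ i, d i ≠ 0 → ((lam i).1 0 * V.1 + (lam i).2 = V.2)) ∧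
        (∃ a₁ b₁ : ℚ, ∀ z ∈ s.domain, (a₁ : ℝ) * (z 0 - V.1) < z 1 - V.2 ∧
          z 1 - V.2 < (b₁ : ℝ) * (z 0 - V.1)))) := by
    intro l hl
    have hel : eb l = if (L l).1 (Fin.last 1) = 0 then e l else 0 := rfl
    by_cases hy : (L l).1 (Fin.last 1) = 0
    · rw [hel, if_pos hy] at hl
      obtain ⟨c₀, hc₀, hb⟩ := Hv l hl hy
      refine Or.inl ⟨c₀, hc₀, fun z hz => ?_⟩
      have := hb z hz
      have hL : Lb l = restr 1 (L l) := by
        show (if (L l).1 (Fin.last 1) = 0 then restr 1 (L l) else (0, 1)) = _; rw [if_pos hy]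
      rwa [affF_of_eq_zero (L l) z hy, ← hL] at this
    · rw [hel, if_neg hy] at hl; exact absurd rfl hl
  -- separation + terminal theorem
  set T : Set KZ.FormalRep := {w | ∃ c ∈ AddSubgroup.closure (GGset 1 1 0),
    w - c ∈ KZ.relations} with hTdef
  have hT := fun (n : ℕ) (L' : Fin n → (Fin 1 → ℚ) × ℚ) (e' : Fin n → ℕ) (d' : Fin m → ℕ)
    (s' : KZ.IntegralRep (1 + 1 + 0)) (ℓ : (Fin 1 → ℚ) × ℚ) hbd'' hdom' hint' hpole'' hℓ hinv =>
    show KZ.of s' ∈ T from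
      terminal M p' lam a lo up V L' e' d' s' ℓ hbd'' hdom' hint' hpole'' hℓ hinv
  obtain ⟨c, hc, hsc⟩ := sepV_induction m' m M p' lam a lo up V (fun j => (L j).1 1 ≠ 0 ∧ e j ≠ 0)
    T hT hfar hnear (∑ j, d j) m Lb eb d s rfl hbd hdom hshape hpole' hact hinv0
  obtain ⟨c', hc', hcc⟩ := closure_transfer' (S := T) (T := GGset 1 1 0) (fun x hx => hx) c hc
  refine ⟨c', hc', ?_⟩
  have := add_mem hsc hcc
  rwa [sub_add_sub_cancel] at this

end PieceThm

end SepTwoZero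

open SepTwoZero SeparatePos in
/-- **stub_separateTwoZero** (line `janus-bands`, crux `ArrangementNormalForm`): separation in a
GOOD RATIONAL DIRECTION for planar arrangement representations without fibres. Every absolutely
convergent `[P, p/∏ Lⱼ^{eⱼ}]` on a bounded open rational polygon `P` (literal `JJ 2 0` data) is
congruent modulo `KZ.relations` to a `ℤ`-combination of elements of `GG 1 1 0`. Proof: the planar
good-direction dissection (`SepTwoZero.dissect`: rule (1a) cuts along letters, pencils and
separators, pigeonhole choice of a direction, rule (2) base change), then on each good piece the
far-first separation (`SepTwoZero.sepV_induction`, rule (1b)) and the terminal theorem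
(`SepTwoZero.terminal`: Taylor split at the last letter, the termwise absolute convergence being
LOCAL power counting at the vertex + the band vanishing lemma along polar edges + compactness). -/
theorem stub_separateTwoZero (JJ : ℕ → ℕ → Set KZ.FormalRep) (GG : ℕ → ℕ → ℕ → Set KZ.FormalRep) (hJJ : ∀ b k, JJ b k = {w : KZ.FormalRep | ∃ (m m' : ℕ) (s : KZ.IntegralRep (b + k)) (M : Fin m' → (Fin b → ℚ) × ℚ) (L : Fin m → (Fin b → ℚ) × ℚ) (e : Fin m → ℕ) (p : MvPolynomial (Fin b) ℚ) (a : Fin k → Option ((Fin b → ℚ) × ℚ)) (lo hi : Fin k → Fin k ⊕ ((Fin b → ℚ) × ℚ)), Bornology.IsBounded s.domain ∧ s.domain = {z | (∀ j, 0 < ∑ i, ((M j).1 i : ℝ) * z (Fin.castAdd k i) + ((M j).2 : ℝ)) ∧ ∀ i, Sum.elim (fun j => z (Fin.natAdd b j)) (fun c => ∑ i', (c.1 i' : ℝ) * z (Fin.castAdd k i') + (c.2 : ℝ)) (lo i) < z (Fin.natAdd b i) ∧ z (Fin.natAdd b i) < Sum.elim (fun j => z (Fin.natAdd b j)) (fun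 c => ∑ i', (c.1 i' : ℝ) * z (Fin.castAdd k i') + (c.2 : ℝ)) (hi i)} ∧ EqOn s.integrand (fun z => MvPolynomial.aeval (fun i => z (Fin.castAdd k i)) p / (∏ j, (∑ i, ((L j).1 i : ℝ) * z (Fin.castAdd k i) + ((L j).2 : ℝ)) ^ e j) * ∏ i, (a i).elim 1 (fun c => 1 / (z (Fin.natAdd b i) - (∑ i', (c.1 i' : ℝ) * z (Fin.castAdd k i') + (c.2 : ℝ))))) s.domain ∧ w = KZ.of s}) (hGG : ∀ b σ k, GG b σ k = {w : KZ.FormalRep | ∃ (m m' n₁ n₂ : ℕ) (s : KZ.IntegralRep (b + 1 + k)) (M : Fin m' → (Fin (b + 1) → ℚ) × ℚ) (L : Fin m → (Fin b → ℚ) × ℚ) (e : Fin m → ℕ) (p : MvPolynomial (Fin b) ℚ) (ℓ₁ ℓ₂ : (Fin b → ℚ) × ℚ) (a : Fin k → Option ((Fin (b + 1) → ℚ) × ℚ)) (lo hi : Fin k → Fin k ⊕ ((Fin (b + 1) → ℚ) × ℚ)), (n₁ = 0 ∨ n₂ = 0) ∧ (σ = 2 → (∀ i c, a i = some c → c.1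 (Fin.last b) = 0) ∧ (∀ i c, (lo i = Sum.inr c ∨ hi i = Sum.inr c) → (c.1 (Fin.last b) = 0 ∨ c = (Pi.single (Fin.last b) 1, 0)))) ∧ Bornology.IsBounded s.domain ∧ s.domain = {z | (∀ j, 0 < ∑ i, ((M j).1 i : ℝ) * z (Fin.castAdd k i) + ((M j).2 : ℝ)) ∧ ∀ i, Sum.elim (fun j => z (Fin.natAdd (b + 1) j)) (fun c => ∑ i', (c.1 i' : ℝ) * z (Fin.castAdd k i') + (c.2 : ℝ)) (lo i) < z (Fin.natAdd (b + 1) i) ∧ z (Fin.natAdd (b + 1) i) < Sum.elim (fun j => z (Fin.natAdd (b + 1) j)) (fun c => ∑ i', (c.1 i' : ℝ) * z (Fin.castAdd k i') + (c.2 : ℝ)) (hi i)} ∧ EqOn s.integrand (fun z => MvPolynomial.aeval (fun i => z (Fin.castAdd k (Fin.castSucc i))) p / (∏ j, (∑ i, ((L j).1 i : ℝ) * z (Fin.castAdd k (Fin.castSucc i)) + ((L j).2 : ℝ)) ^ e j) * ((z (Fin.castAdd k (Fin.last b)) - (∑ i, (ℓ₁.1 i : ℝ) * z (Fin.castAdd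 k (Fin.castSucc i)) + (ℓ₁.2 : ℝ))) ^ n₁ / (z (Fin.castAdd k (Fin.last b)) - (∑ i, (ℓ₂.1 i : ℝ) * z (Fin.castAdd k (Fin.castSucc i)) + (ℓ₂.2 : ℝ))) ^ n₂) * ∏ i, (a i).elim 1 (fun c => 1 / (z (Fin.natAdd (b + 1) i) - (∑ i', (c.1 i' : ℝ) * z (Fin.castAdd k i') + (c.2 : ℝ))))) s.domain ∧ w = KZ.of s}) : ∀ x ∈ JJ 2 0, ∃ c ∈ AddSubgroup.closure (GG 1 1 0), x - c ∈ KZ.relations := by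
  classical
  intro x hx
  rw [hJJ] at hx
  obtain ⟨m, m', s, M, L, e, p, a, lo, hi, hbd, hdom, hint, rfl⟩ := hx
  rw [show GG 1 1 0 = GGset 1 1 0 from hGG 1 1 0]
  by_cases hL : ∀ i, e i ≠ 0 → L i ≠ 0
  · obtain ⟨c, hc, hrel⟩ := dissect {w | ∃ c ∈ AddSubgroup.closure (GGset 1 1 0),
        w - c ∈ KZ.relations}
      (fun m₁ m₁' s₁ M₁ L₁ e₁ p₁ a₁ lo₁ hi₁ 𝒳 hbd₁ hdom₁ hint₁ HX Ha Hb hpole Hv =>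
        piece_theorem s₁ M₁ L₁ e₁ p₁ a₁ lo₁ hi₁ hbd₁ hdom₁ hint₁ 𝒳 HX Ha Hb hpole Hv)
      m m' s M L e p a lo hi hbd hdom hint hL
    obtain ⟨c', hc', hcc⟩ := closure_transfer' (fun x hx => hx) c hc
    refine ⟨c', hc', ?_⟩
    have := add_mem hrel hcc
    rwa [sub_add_sub_cancel] at this
  · push Not at hL
    obtain ⟨i, hei, hLi⟩ := hL
    refine ⟨0, zero_mem _, ?_⟩
    rw [sub_zero]
    refine KZ.of_mem_relations_of_eqOn_zero s fun z hz => ?_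
    rw [hint hz]
    have h0 : (∑ i', ((L i).1 i' : ℝ) * z (Fin.castAdd 0 i') + ((L i).2 : ℝ)) ^ e i = 0 := by
      rw [hLi]; simp [zero_pow hei]
    simp only [Pi.zero_apply]
    rw [Finset.prod_eq_zero (Finset.mem_univ i) h0, div_zero, zero_mul]

end Summit.KontsevichZagierPeriods.ArrangementNormalForm.JanusBands
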